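import Literature.MathematicalPhysics.QuantumLattice.LatticeGaugeDLRLimitPointsProofs
import Literature.MathematicalPhysics.QuantumFieldTheory.ShenZhuZhuOrthogonal
import Literature.MathematicalPhysics.QuantumFieldTheory.StrongCouplingClustering
import HarnessLib

/-!
# The named fact `shenZhuZhu_uniqueLimit 3 2` (Shen–Zhu–Zhu CMP 400 (2023), Theorem 1.2 (2): uniqueness and existence of the infinite-volume
# limit) is a THEOREM for `SU(2)` lattice Yang–Mills in three dimensions — and the soft lemma behind it: a unique limit point is THE limit

Seat `ym-line-csu-p1` (g38), route `ColdStartUniversality` of `Summits/QuantumFields/YangMills`, helper file G13.  The Literature vendors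
Shen–Zhu–Zhu's Theorem 1.2 (2) — under Assumption 1.1 the set of infinite-volume limit points of the periodic Wilson states is a subsingleton AND the
full sequence of torus states converges (`IsInfiniteVolumeLimit`) — as the named fact `shenZhuZhu_uniqueLimit d N` (`ShenZhuZhuOrthogonal`, a
`def … : Prop`).  The subsingleton half for `SU(N)`, `N ≥ 2`, is the tree's `subsingleton_infiniteVolumeLimitPoints_SU` (Dobrushin route,
`shen_zhu_zhu_holds`); the existence-of-the-limit half is soft compactness, supplied here in general:

* `exists_infiniteVolumeLimitAlong_subseq` (every compact second-countable gauge group, every continuous `ρ`, every `β`) — along EVERY sequence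
  of torus sizes there is a subsequence along which the torus Wilson states converge on bounded continuous cylinder observables (Prokhorov; the
  tree's `infiniteVolumeLimitPoints_nonempty_holds` is the case of the full sequence).
* ★★ `isInfiniteVolumeLimit_of_subsingleton` — if the infinite-volume limit points form a subsingleton, every limit point is the limit of the
  FULL sequence of torus states (sub-subsequence argument).
* ★★★ `hasUniqueInfiniteVolumeLimit_su2_d3` — the INTENDED content of SZZ Theorem 1.2 (2) for `SU(2)`, `d = 3`, in the tree's vocabulary
  (`HasUniqueInfiniteVolumeLimit`): for every 't Hooft `|β| < 1/32` the torus `SU(2)` Wilson states at tree coupling `2β` converge, as `L → ∞`, to a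
  probability measure `μ` which is the only infinite-volume limit point.
* `exists_freeBoundary_infiniteVolumeLimit` (every compact second-countable gauge group, continuous `ρ`, every `β`) — the free-boundary cube
  states `μ_{[-L,L]^d, β}` have a weak subsequential limit (`Sweep1`'s `QuantumFieldTheory.IsInfiniteVolumeLimit`), by the same compactness.
* ★★★ `shenZhuZhu_uniqueLimit_su2_d3 : shenZhuZhu_uniqueLimit 3 2` — the NAMED FACT as typed.  FLAG (faithfulness of the Literature statement,
  for the auditors): inside `namespace …QuantumFieldTheory` the identifier `IsInfiniteVolumeLimit` in `shenZhuZhu_uniqueLimit` resolves to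
  `Sweep1`'s FREE-BOUNDARY subsequential-limit predicate `QuantumFieldTheory.IsInfiniteVolumeLimit` (not to the periodic full-sequence predicate
  `QuantumLattice.IsInfiniteVolumeLimit` its docstring describes); the typed second half is therefore bare existence of a free-boundary limit
  point (compactness), which we prove for every `β`; the intended statement is `hasUniqueInfiniteVolumeLimit_su2_d3` above.  The `SO(2)` conjunct
  is vacuous (SZZ's threshold `1/(32(d−1)) − 1/(16N(d−1))` vanishes at `N = 2`).

THEOREMS ONLY, no definition, no sorry.  HONEST FRAMING: this discharges a vendored LITERATURE statement at STRONG coupling for ONE group and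
dimension; the deep input (DLR uniqueness) is the tree's; fixed lattice; nothing at weak coupling / in the continuum, nothing `K`-uniform along the
route's scaling (`UniformColdStartMixing`, 24809, ASIDE, not restated); no crux, rung or summit statement is proved; the Yang–Mills mass gap is NOT
proved.

References: H. Shen, R. Zhu, X. Zhu, CMP 400 (2023) 805–851 = arXiv:2204.12737, Theorem 1.2 (2) [ShenZhuZhu2022]; E. Seiler, LNP 159 (1982), Ch. 2.
-/

set_option autoImplicit false

noncomputable section

namespace Summit.QuantumFields.YangMills.Theorems.ColdStartUniversality

open MeasureTheory Filter Topology
open Literature.MathematicalPhysics.QuantumFieldTheory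
open Literature.MathematicalPhysics.QuantumLattice (fundamentalRep continuous_fundamentalRep infiniteVolumeLimitPoints IsInfiniteVolumeLimitAlong
  LGConfig toTorusObservable infiniteVolumeLimitPoints_nonempty_holds HasUniqueInfiniteVolumeLimit)

/-! ## §1. Soft compactness: subsequential limits along any sequence of volumes; a unique limit point is the limit -/

section Soft

variable {d N : ℕ} {G : Type*} [Group G] [TopologicalSpace G] [IsTopologicalGroup G] [CompactSpace G]
  [MeasurableSpace G] [BorelSpace G] [T2Space G] [SecondCountableTopology G]

/-- **Subsequential infinite-volume limits along any sequence of volumes**: for a continuous representation `ρ` of the compact second-countable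
gauge group `G`, every `β` and every sequence of torus sizes `L_n + 1`, some subsequence of the torus Wilson states converges on all bounded
continuous cylinder observables to a probability measure on `G^{edges(ℤ^d)}` (Prokhorov / Riesz–Markov: the probability measures on the compact
metrizable configuration space form a compact metrizable space). [cite: arXiv180301950, §2] -/
theorem exists_infiniteVolumeLimitAlong_subseq (ρ : G →* Matrix (Fin N) (Fin N) ℂ) (hρ : Continuous ρ) (β : ℝ) (L : ℕ → ℕ) :
    ∃ φ : ℕ → ℕ, StrictMono φ ∧ ∃ μ : Measure (LGConfig d G), IsInfiniteVolumeLimitAlong (d := d) ρ β (L ∘ φ) μ := by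
  haveI := fun n : ℕ => isProbabilityMeasure_torusState (d := d) (L := n + 1) ρ hρ β
  let P : ℕ → ProbabilityMeasure (LGConfig d G) := fun n => ⟨torusState ρ β (L n + 1), inferInstance⟩
  obtain ⟨μ, -, φ, hφ, hlim⟩ :=
    (isCompact_univ (X := ProbabilityMeasure (LGConfig d G))).tendsto_subseq fun n => Set.mem_univ (P n)
  refine ⟨φ, hφ, (μ : Measure (LGConfig d G)), inferInstance, fun F S _ hFc hFb => ?_⟩
  obtain ⟨C, hC⟩ := hFb
  let Fb : BoundedContinuousFunction (LGConfig d G) ℝ :=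
    BoundedContinuousFunction.ofNormedAddCommGroup F hFc C (fun U => by simpa [Real.norm_eq_abs] using hC U)
  have hE : (fun k : ℕ => wilsonExpectation (L := (L ∘ φ) k + 1) ρ β (toTorusObservable ((L ∘ φ) k + 1) F)) =
      fun k => ∫ U, Fb U ∂(P (φ k) : Measure (LGConfig d G)) :=
    funext fun k => wilsonExpectation_toTorusObservable ρ β (L (φ k) + 1) hFc.measurable
  have key : Tendsto (fun k : ℕ => ∫ U, Fb U ∂(P (φ k) : Measure (LGConfig d G))) atTop
      (𝓝 (∫ U, Fb U ∂(μ : Measure (LGConfig d G)))) :=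
    (ProbabilityMeasure.tendsto_iff_forall_integral_tendsto.1 hlim) Fb
  rw [hE]
  exact key

/-- ★★ **A unique infinite-volume limit point is the infinite-volume limit**: if the limit points of the torus Wilson states at coupling `β` form a
subsingleton, then every limit point `μ` is the limit of the FULL sequence of torus states on bounded continuous cylinder observables
(`IsInfiniteVolumeLimit`): every subsequence has a further subsequence converging to a limit point, which must be `μ`. [folklore] -/
theorem isInfiniteVolumeLimit_of_subsingleton (ρ : G →* Matrix (Fin N) (Fin N) ℂ) (hρ : Continuous ρ) (β : ℝ)
    (hsub : (infiniteVolumeLimitPoints (d := d) ρ β).Subsingleton)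
    {μ : Measure (LGConfig d G)} (hμ : μ ∈ infiniteVolumeLimitPoints (d := d) ρ β) :
    Literature.MathematicalPhysics.QuantumLattice.IsInfiniteVolumeLimit (d := d) ρ β μ := by
  obtain ⟨L₀, hL₀, hprob, hlim₀⟩ := hμ
  have hμmem : μ ∈ infiniteVolumeLimitPoints (d := d) ρ β := ⟨L₀, hL₀, hprob, hlim₀⟩
  refine ⟨hprob, fun F S hFS hFc hFb => ?_⟩
  refine tendsto_of_subseq_tendsto fun ns hns => ?_
  obtain ⟨φ₁, -, hφ₁⟩ := strictMono_subseq_of_tendsto_atTop hns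
  obtain ⟨φ₂, hφ₂, ν, hν⟩ := exists_infiniteVolumeLimitAlong_subseq (d := d) ρ hρ β (ns ∘ φ₁)
  have hνmem : ν ∈ infiniteVolumeLimitPoints (d := d) ρ β := ⟨(ns ∘ φ₁) ∘ φ₂, hφ₁.comp hφ₂, hν⟩
  have heq : ν = μ := hsub hνmem hμmem
  refine ⟨φ₁ ∘ φ₂, ?_⟩
  have h := hν.2 F S hFS hFc hFb
  rw [heq] at h
  exact h

/-- **A unique limit point gives `HasUniqueInfiniteVolumeLimit`.** [folklore] -/
theorem hasUniqueInfiniteVolumeLimit_of_subsingleton (ρ : G →* Matrix (Fin N) (Fin N) ℂ) (hρ : Continuous ρ) (β : ℝ)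
    (hsub : (infiniteVolumeLimitPoints (d := d) ρ β).Subsingleton) :
    HasUniqueInfiniteVolumeLimit (d := d) ρ β := by
  obtain ⟨μ, hμ⟩ := infiniteVolumeLimitPoints_nonempty_holds (d := d) ρ hρ β
  refine ⟨μ, isInfiniteVolumeLimit_of_subsingleton (d := d) ρ hρ β hsub hμ, ?_⟩
  exact Set.eq_singleton_iff_unique_mem.2 ⟨hμ, fun ν hν => hsub hν hμ⟩

/-- **Free-boundary infinite-volume limit points exist** (every `β`): the free-boundary Wilson states on the centred cubes `[-L, L]^d` have a weak
subsequential limit — `Sweep1`'s predicate `QuantumFieldTheory.IsInfiniteVolumeLimit` is inhabited — by compactness of the probability measures on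
the compact metrizable configuration space `G^{edges(ℤ^d)}`. [cite: arXiv180301950, §3] -/
theorem exists_freeBoundary_infiniteVolumeLimit (ρ : G →* Matrix (Fin N) (Fin N) ℂ) (hρ : Continuous ρ) (β : ℝ) :
    ∃ μ : Measure (ZdGaugeConfig d G), Literature.MathematicalPhysics.QuantumFieldTheory.IsInfiniteVolumeLimit (d := d) ρ β μ := by
  haveI := fun Λ : Finset (Literature.Probability.LatticeModels.Site d) => isProbabilityMeasure_zdWilsonMeasure (d := d) ρ hρ β Λ
  let P : ℕ → ProbabilityMeasure (ZdGaugeConfig d G) := fun k =>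
    ⟨zdWilsonMeasure ρ β (Literature.Probability.LatticeModels.box d k), inferInstance⟩
  obtain ⟨μ, -, φ, hφ, hlim⟩ :=
    (isCompact_univ (X := ProbabilityMeasure (ZdGaugeConfig d G))).tendsto_subseq fun n => Set.mem_univ (P n)
  refine ⟨(μ : Measure (ZdGaugeConfig d G)), inferInstance, φ, hφ, fun f hf hfb => ?_⟩
  obtain ⟨C, hC⟩ := isBounded_iff_forall_norm_le.1 hfb
  let Fb : BoundedContinuousFunction (ZdGaugeConfig d G) ℝ :=
    BoundedContinuousFunction.ofNormedAddCommGroup f hf C (fun U => hC _ ⟨U, rfl⟩)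
  have key : Tendsto (fun k : ℕ => ∫ U, Fb U ∂(P (φ k) : Measure (ZdGaugeConfig d G))) atTop
      (𝓝 (∫ U, Fb U ∂(μ : Measure (ZdGaugeConfig d G)))) :=
    (ProbabilityMeasure.tendsto_iff_forall_integral_tendsto.1 hlim) Fb
  exact key

end Soft

/-! ## §2. `SU(2)`, `d = 3`: the intended statement and the named fact -/

/-- ★★★ **Shen–Zhu–Zhu's Theorem 1.2 (2) for `SU(2)` lattice Yang–Mills in three dimensions, intended form**: for every 't Hooft coupling
`|β| < 1/32` the torus `SU(2)` Wilson states at tree coupling `2β` have a UNIQUE infinite-volume limit: the full sequence converges (on bounded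
continuous cylinder observables) to a probability measure `μ`, and `μ` is the only subsequential limit point (`HasUniqueInfiniteVolumeLimit`).
Deep input: the tree's DLR uniqueness (`subsingleton_infiniteVolumeLimitPoints_SU`).  Strong coupling; the Yang–Mills mass gap is NOT proved.
[cite: ShenZhuZhu2022, Theorem 1.2] -/
theorem hasUniqueInfiniteVolumeLimit_su2_d3 {β : ℝ} (hβ : |β| < 1 / 32) :
    HasUniqueInfiniteVolumeLimit (d := 3) (fundamentalRep (Fin 2)) (((2 : ℕ) : ℝ) * β) := by
  haveI : SecondCountableTopology (Matrix (Fin 2) (Fin 2) ℂ) :=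
    inferInstanceAs (SecondCountableTopology (Fin 2 → Fin 2 → ℂ))
  haveI : SecondCountableTopology (Matrix.specialUnitaryGroup (Fin 2) ℂ) :=
    Topology.IsEmbedding.subtypeVal.secondCountableTopology
  have hT : szzThresholdSU 3 = 1 / 32 := by norm_num [szzThresholdSU]
  have hβ' : |β| < szzThresholdSU 3 := by rw [hT]; exact hβ
  have hsub := subsingleton_infiniteVolumeLimitPoints_SU (d := 3) (N := 2) (by norm_num) (le_refl 2) hβ'
  exact hasUniqueInfiniteVolumeLimit_of_subsingleton (d := 3) (fundamentalRep (Fin 2)) (continuous_fundamentalRep (Fin 2)) _ hsub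

/-- ★★★ **THE NAMED FACT `shenZhuZhu_uniqueLimit 3 2` IS A THEOREM**: Shen–Zhu–Zhu's Theorem 1.2 (2) for `SU(2)` lattice Yang–Mills in three
dimensions — for every 't Hooft coupling `|β| < 1/32` the infinite-volume limit points of the torus `SU(2)` Wilson states at tree coupling `2β` form
a subsingleton (the tree's `subsingleton_infiniteVolumeLimitPoints_SU`, Dobrushin route) AND the full sequence of torus states converges to it
— see `hasUniqueInfiniteVolumeLimit_su2_d3` for that intended statement; AS TYPED the fact's second half is `Sweep1`'s free-boundary
subsequential-limit predicate (name resolution inside `namespace …QuantumFieldTheory`), inhabited by compactness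
(`exists_freeBoundary_infiniteVolumeLimit`); the `SO(2)` conjunct is vacuous (threshold `0`).  HONEST FRAMING: strong coupling; the Yang–Mills
mass gap is NOT proved. [cite: ShenZhuZhu2022, Theorem 1.2] -/
theorem shenZhuZhu_uniqueLimit_su2_d3 : shenZhuZhu_uniqueLimit 3 2 := by
  refine ⟨fun hd _ β hβ => ?_, fun _ _ β hβ => ?_⟩
  · haveI : SecondCountableTopology (Matrix (Fin 2) (Fin 2) ℂ) :=
      inferInstanceAs (SecondCountableTopology (Fin 2 → Fin 2 → ℂ))
    haveI : SecondCountableTopology (Matrix.specialUnitaryGroup (Fin 2) ℂ) :=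
      Topology.IsEmbedding.subtypeVal.secondCountableTopology
    have hsub := subsingleton_infiniteVolumeLimitPoints_SU (d := 3) (N := 2) hd (le_refl 2) hβ
    exact ⟨hsub, exists_freeBoundary_infiniteVolumeLimit (d := 3) (fundamentalRep (Fin 2)) (continuous_fundamentalRep (Fin 2)) _⟩
  · have hT : szzThresholdSO 2 3 = 0 := by norm_num [szzThresholdSO]
    rw [hT] at hβ
    exact absurd hβ (not_lt.2 (abs_nonneg β))

end Summit.QuantumFields.YangMills.Theorems.ColdStartUniversality

end
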